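import Literature.Geometry.Lorentzian.GeodesicExistence
import Literature.Geometry.Lorentzian.ChartCalculus
import HarnessLib

/-!
# The geodesic equations of a metric on an open subset of a normed space, in coordinates
(trunk G08 = T-LORENTZ; namespace `Literature.Geometry.Lorentzian.OpensChart`)

For a `C^n` pseudo-Riemannian metric `g` (`1 ≤ n`, with its Levi-Civita connection,
`[g.HasLeviCivita]`) on an open subset `U : Opens E` of a finite-dimensional real normed space,
with differentiable components `G : E → (E →L E →L ℝ)` (`g.val y = G y`), this file proves the
classical **sufficient condition for a curve to be a geodesic**, read in the single chart `U`
(O'Neill 1983, Ch. 3, Cor. 21, p. 67: "`γ` is a geodesic iff `(xᵏ ∘ γ)'' + ∑ Γᵏᵢⱼ (xⁱ ∘ γ)'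
(xʲ ∘ γ)' = 0`", the "if" direction): if the coordinate expression `c = Subtype.val ∘ γ : ℝ → E`
of a curve `γ : ℝ → U` has derivatives `c'`, `c''` on an open parameter set `s` and
`c''(t) + Γ_{γ t}(c'(t), c'(t)) = 0` there, `Γ` being the Christoffel map `OpensChart.christoffel`
of the components (`ChartCalculus.lean`: `∇_{X₀} Y₀ = Γ(X₀, Y₀)` on constant fields,
`2 g(Γ(X₀, Y₀), Z₀) = ∂_{X₀}G(Y₀, Z₀) + ∂_{Y₀}G(Z₀, X₀) − ∂_{Z₀}G(X₀, Y₀)`), then `γ` is a geodesic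
of `g.leviCivita` on `s` in the sense of `Geodesic.lean` (`IsGeodesicOn`: differentiable tangent
lift and `D(γ')/dt = 0`), and its velocity is `γ'(t) = c'(t)`
(`OpensChart.isGeodesicOn_of_hasDerivAt`).

The proof is the computation of O'Neill's Cor. 21 already formalised for the local existence
theorem (`GeodesicExistence.lean`): in the trivialisation of `TU` at a point — which for the chart
`U` is the identity (`OpensChart.trivializationAt_apply`), with coordinate frame the *constant*
fields `bᵢ` (`OpensChart.localFrame_trivializationAt`) — the acceleration `D(γ')/dt` reads
`c'' + ∑ᵢ c'ⁱ ∇_{c'} bᵢ = c'' + Γ(c', c')` (`continuousLinearMapAt_covariantDerivAlong_velocity`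
with `Ĉᵢ(y) = Γ_y(·, bᵢ)`, `OpensChart.leviCivita_const_apply`). This is the bridge by which
explicit curves of the concrete metrics of the library (Kerr–Schild Kerr, `KerrSchild.lean`) are
shown to be geodesics, e.g. the circular photon orbits of `KerrPhotonOrbit.lean`.

## References

* B. O'Neill, *Semi-Riemannian geometry with applications to relativity*, Academic Press 1983,
  Ch. 3: Prop. 13 (Christoffel symbols), Prop. 18 (induced covariant derivative), Cor. 21 (the
  geodesic equations in a chart) (key `ONeill1983`).
-/

noncomputable section

open Bundle Set Filter TopologicalSpace
open scoped Manifold ContDiff Topology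

namespace Literature.Geometry.Lorentzian

namespace OpensChart

variable {E : Type*} [NormedAddCommGroup E] [NormedSpace ℝ E] {U : Opens E}

/-- **The coordinate frame of the chart `U` is constant**: the local frame of `TU` induced by the
preferred trivialisation at `x` (the identity, `trivializationAt_apply`) and a basis `b` of `E`
is the family of constant vector fields `y ↦ bᵢ` (O'Neill 1983, Ch. 3, proof of Prop. 13:
coordinate vector fields `∂ᵢ`). [cite: ONeill1983, Ch. 3, Prop. 3.13] -/
theorem localFrame_trivializationAt [FiniteDimensional ℝ E] (x : U) {ι : Type*}
    (b : Module.Basis ι ℝ E) (i : ι) :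
    (trivializationAt E (TangentSpace 𝓘(ℝ, E)) x).localFrame b i = fun _ : U ↦ (b i : E) := by
  funext y
  have hy : y ∈ (trivializationAt E (TangentSpace 𝓘(ℝ, E)) x).baseSet := by
    simp [chartAt_source]
  rw [Trivialization.localFrame_apply_of_mem_baseSet _ _ hy]
  simp only [Trivialization.basisAt, Module.Basis.map_apply,
    Trivialization.linearEquivAt_symm_apply]
  exact trivializationAt_symm_apply x y (b i)

variable [FiniteDimensional ℝ E] {n : ℕ∞ω}
  {g : PseudoRiemannianMetric 𝓘(ℝ, E) n E (TangentSpace 𝓘(ℝ, E) : U → Type _)}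
  {G : E → E →L[ℝ] E →L[ℝ] ℝ}

/-- The Christoffel map is linear in its vector-field slot: `Γ_x(X₀, ∑ cᵢ Yᵢ) = ∑ cᵢ Γ_x(X₀, Yᵢ)`
(from `christoffel_add`, `christoffel_smul`). O'Neill 1983, Ch. 3, Prop. 13. [folklore] -/
theorem christoffel_sum {ι : Type*} (t : Finset ι) (x : U) (c : ι → ℝ) (Y : ι → E) (X₀ : E) :
    christoffel g G x (∑ i ∈ t, c i • Y i) X₀ = ∑ i ∈ t, c i • christoffel g G x (Y i) X₀ := by
  classical
  induction t using Finset.induction_on with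
  | empty =>
      simp only [Finset.sum_empty]
      have h := christoffel_smul (g := g) (G := G) x (0 : ℝ) (0 : E) X₀
      rwa [zero_smul, zero_smul] at h
  | insert i t hi ih =>
      rw [Finset.sum_insert hi, Finset.sum_insert hi, christoffel_add, christoffel_smul, ih]

/-- **The geodesic equations in the chart `U`, sufficiency** (O'Neill 1983, Ch. 3, Cor. 21, "if"
direction). Let `g` be a `C^n` metric on `U : Opens E`, `1 ≤ n`, with its Levi-Civita connection
and with components `G` (`g.val y = G y`) differentiable at every point. Let `γ : ℝ → U` be a curve
with coordinate expression `c` (`(γ t : E) = c t` for all `t`) having derivatives `c'`, `c''` on an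
open set `s` of parameters, and suppose `c''(t) + Γ_{γ t}(c'(t), c'(t)) = 0` for `t ∈ s`. Then `γ`
is a geodesic of `g.leviCivita` on `s` (`IsGeodesicOn`) and `γ'(t) = c'(t)` there.
[cite: ONeill1983, Ch. 3, Cor. 21] -/
theorem isGeodesicOn_of_hasDerivAt [g.HasLeviCivita] (hG : ∀ y : U, g.val y = G y)
    (hGd : ∀ y : U, DifferentiableAt ℝ G y) {γ : ℝ → U} {c c' c'' : ℝ → E} {s : Set ℝ}
    (hs : IsOpen s) (hγc : ∀ t, (γ t : E) = c t)
    (hc : ∀ t ∈ s, HasDerivAt c (c' t) t) (hc' : ∀ t ∈ s, HasDerivAt c' (c'' t) t)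
    (hgeo : ∀ t ∈ s, c'' t + christoffel g G (γ t) (c' t) (c' t) = 0) :
    IsGeodesicOn g.leviCivita γ s ∧ ∀ t ∈ s, velocity 𝓘(ℝ, E) γ t = c' t := by
  set x₀ : U := γ 0 with hx₀_def
  set φ := extChartAt 𝓘(ℝ, E) x₀ with hφ_def
  set b := Module.finBasis ℝ E with hb_def
  -- the curve is the inverse chart applied to its coordinate expression
  have hγφ : ∀ t, γ t = φ.symm (c t) := fun t ↦ by
    apply Subtype.ext
    rw [hγc t, hφ_def, extChartAt_symm_val x₀ (by rw [← hγc t]; exact (γ t).2)]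
  have hsrc : ∀ t, γ t ∈ (chartAt E x₀).source := fun t ↦ by simp [chartAt_source]
  have htgt : ∀ t, c t ∈ φ.target := fun t ↦ by
    rw [hφ_def, extChartAt_target, ← hγc t]
    exact (γ t).2
  have hφγ : φ ∘ γ = c := funext fun t ↦ by
    simp only [Function.comp_apply, hφ_def, extChartAt_apply, hγc t]
  -- differentiability of the curve
  have hγd : ∀ t ∈ s, MDifferentiableAt 𝓘(ℝ, ℝ) 𝓘(ℝ, E) γ t := by
    intro t ht
    have h1 : MDifferentiableAt 𝓘(ℝ, E) 𝓘(ℝ, E) φ.symm (c t) :=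
      (mdifferentiableWithinAt_extChartAt_symm (htgt t)).mdifferentiableAt
        (by rw [ModelWithCorners.range_eq_univ]; exact univ_mem)
    have h2 : MDifferentiableAt 𝓘(ℝ, ℝ) 𝓘(ℝ, E) c t :=
      mdifferentiableAt_iff_differentiableAt.2 (hc t ht).differentiableAt
    have h3 := h1.comp t h2
    have h4 : (φ.symm ∘ c) = γ := funext fun t' ↦ (hγφ t').symm
    rwa [h4] at h3
  -- the velocity read in the trivialisation is `c'`
  have hUeq : ∀ t ∈ s,
      ((trivializationAt E (TangentSpace 𝓘(ℝ, E)) x₀) (tangentLift 𝓘(ℝ, E) γ t)).2 = c' t := by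
    intro t ht
    have h1 : HasDerivAt (φ ∘ γ)
        (((trivializationAt E (TangentSpace 𝓘(ℝ, E)) x₀) ⟨γ t, velocity 𝓘(ℝ, E) γ t⟩).2) t :=
      hasDerivAt_extChartAt_comp (hγd t ht) (hsrc t)
    rw [hφγ] at h1
    exact h1.unique (hc t ht)
  have hUev : ∀ t ∈ s,
      (fun t' ↦ ((trivializationAt E (TangentSpace 𝓘(ℝ, E)) x₀) (tangentLift 𝓘(ℝ, E) γ t')).2)
        =ᶠ[𝓝 t] c' := fun t ht ↦ by
    filter_upwards [hs.mem_nhds ht] with t' ht' using hUeq t' ht'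
  -- differentiability of the tangent lift
  have hLd : ∀ t ∈ s, MDifferentiableAt 𝓘(ℝ, ℝ) 𝓘(ℝ, E).tangent (tangentLift 𝓘(ℝ, E) γ) t := by
    intro t ht
    have hm : tangentLift 𝓘(ℝ, E) γ t ∈
        (trivializationAt E (TangentSpace 𝓘(ℝ, E)) x₀).source :=
      (trivializationAt E (TangentSpace 𝓘(ℝ, E)) x₀).mem_source.2 (by simp [chartAt_source])
    refine ((trivializationAt E (TangentSpace 𝓘(ℝ, E)) x₀).mdifferentiableAt_totalSpace_iff 𝓘(ℝ, E)
      (tangentLift 𝓘(ℝ, E) γ) hm).2 ⟨hγd t ht, ?_⟩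
    exact mdifferentiableAt_iff_differentiableAt.2
      ((hc' t ht).differentiableAt.congr_of_eventuallyEq (hUev t ht))
  -- the Christoffel data of the chart: `Ĉᵢ(y) w = ∇_w bᵢ = Γ_y(w, bᵢ)`
  set Ĉ : Fin (Module.finrank ℝ E) → U → (E →L[ℝ] E) := fun i y ↦ christoffel g G y (b i)
    with hĈ_def
  have hN : (univ : Set U) ⊆ (chartAt E x₀).source := fun y _ ↦ by simp [chartAt_source]
  have hĈ : ∀ y ∈ (univ : Set U), ∀ (i) (w : TangentSpace 𝓘(ℝ, E) y),
      Ĉ i y ((trivializationAt E (TangentSpace 𝓘(ℝ, E)) x₀).continuousLinearMapAt ℝ y w) =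
        ((trivializationAt E (TangentSpace 𝓘(ℝ, E)) x₀)
          ⟨y, g.leviCivita ((trivializationAt E (TangentSpace 𝓘(ℝ, E)) x₀).localFrame b i)
            y w⟩).2 := by
    intro y _ i w
    rw [continuousLinearMapAt_trivializationAt_apply, trivializationAt_apply,
      localFrame_trivializationAt]
    exact (leviCivita_const_apply hG y (hGd y) (b i) w).symm
  refine ⟨⟨hLd, fun t ht ↦ ?_⟩, fun t ht ↦ ?_⟩
  · -- the acceleration vanishes
    have hte : γ t ∈ (trivializationAt E (TangentSpace 𝓘(ℝ, E)) x₀).baseSet := by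
      simp [chartAt_source]
    have hA := continuousLinearMapAt_covariantDerivAlong_velocity (cov := g.leviCivita) b hN Ĉ hĈ
      (mem_univ (γ t)) (hLd t ht)
    rw [(hUev t ht).deriv_eq, (hc' t ht).deriv, hUeq t ht] at hA
    have hsum : ∑ i, b.repr (c' t) i • Ĉ i (γ t) (c' t) =
        christoffel g G (γ t) (c' t) (c' t) := by
      simp only [hĈ_def]
      rw [← christoffel_sum, b.sum_repr]
    rw [hsum, hgeo t ht] at hA
    have hinj : Function.Injective
        ((trivializationAt E (TangentSpace 𝓘(ℝ, E)) x₀).continuousLinearMapAt ℝ (γ t)) := by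
      rw [← Trivialization.coe_continuousLinearEquivAt_eq _ hte]
      exact ((trivializationAt E (TangentSpace 𝓘(ℝ, E)) x₀).continuousLinearEquivAt ℝ (γ t)
        hte).injective
    exact hinj (by rw [hA, map_zero])
  · -- the velocity
    have h := hUeq t ht
    rwa [show tangentLift 𝓘(ℝ, E) γ t = ⟨γ t, velocity 𝓘(ℝ, E) γ t⟩ from rfl,
      trivializationAt_apply] at h

/-- **Geodesics on all of `ℝ` in the chart `U`**: under the hypotheses of
`isGeodesicOn_of_hasDerivAt` on `s = univ`, `γ` is a geodesic (`IsGeodesic`) with velocity `c'`.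
O'Neill 1983, Ch. 3, Cor. 21. [cite: ONeill1983, Ch. 3, Cor. 21] -/
theorem isGeodesic_of_hasDerivAt [g.HasLeviCivita] (hG : ∀ y : U, g.val y = G y)
    (hGd : ∀ y : U, DifferentiableAt ℝ G y) {γ : ℝ → U} {c c' c'' : ℝ → E}
    (hγc : ∀ t, (γ t : E) = c t)
    (hc : ∀ t, HasDerivAt c (c' t) t) (hc' : ∀ t, HasDerivAt c' (c'' t) t)
    (hgeo : ∀ t, c'' t + christoffel g G (γ t) (c' t) (c' t) = 0) :
    IsGeodesic g.leviCivita γ ∧ ∀ t, velocity 𝓘(ℝ, E) γ t = c' t := by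
  obtain ⟨h1, h2⟩ := isGeodesicOn_of_hasDerivAt hG hGd isOpen_univ hγc (fun t _ ↦ hc t)
    (fun t _ ↦ hc' t) (fun t _ ↦ hgeo t)
  exact ⟨h1, fun t ↦ h2 t (mem_univ t)⟩

end OpensChart

end Literature.Geometry.Lorentzian

end
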